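/-
Origin: expansion seat `planner-pub-hodgecm-pv05-0`, handover 2026-08-18T03:56:20Z (`HOME/pub-hodgecm-pv05/lean/Pv05/PeterssonFubini.lean`, md5 66c9444e, 210 lines);
landed by the gen-5 packager in gate run 20 as `HodgeCM/PerL34/PeterssonFubini.lean` (verbatim).
-/
/-
pub-hodgecm speedrun cell, prover pv05 — WIP module `Pv05.PeterssonFubini` (proposed landing place
`HodgeCM/PerL34/PeterssonFubini.lean`, namespace `HodgeCM.PerL34.PeterssonFubini`).  Imports: Mathlib +
the landed `HodgeCM.PerL34.RallisField` (pv09; only for the final by-name plug `rallis_field_of_theta`).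
Nothing posited, nothing cited: measure theory (Fubini for a bounded kernel on finite measure spaces).

# The `hnorm` input of the N31 chain, kernel-proved (PerL v5 tex ll. 594–596; nodes N10/N31d/N31e)

pv09's plug `HodgeCM.PerL34.RallisIP.rallis_field_of_N31e` (node N31e ⇒ pv13's `LocalFactorDatum.rallis`)
takes, besides N31e and the Euler factorisation, the hypothesis
  `hnorm : ⟪θ, θ⟫_ℂ = ∫ u in 𝓕, ∫ u' in 𝓕, χ' u * conj (χ' u') * K u u' ∂μ ∂μ`
labelled "definition of `θ_φ(χ′) = ∫_{[U(W_i)]} θ_φ(·,u)χ′(u)du` and of `K` as the `[G_U]`-inner integral,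
tex l. 594–596".  It is a definition PLUS a Fubini interchange; this file proves the interchange in Mathlib
generality.  Setting: `(X, μ)` a finite measure space (`[G_U]`, compact), `(Y, ν)` a finite measure space
(`[U(W_i)]`; with pv09's model `ν := μ_A.restrict 𝓕`, so that `∫ u in 𝓕, … ∂μ_A` is literally `∫ u, … ∂ν`),
a bounded jointly measurable kernel `k : X → Y → ℂ` (the theta kernel `θ_φ(g,u)`, continuous on the compact
`[G_U] × [U(W_i)]`) and a bounded measurable `χ : Y → ℂ` (the automorphic character `χ′`, `|χ′| = 1`).
* `thetaFun ν k χ x := ∫ y, k x y * χ y ∂ν` — the theta lift `θ_φ(χ′)(g)` (l. 594), bounded and measurable,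
  hence in `L²(μ)`: `theta μ ν k χ … : Lp ℂ 2 μ`;
* **`inner_theta_theta`**: `⟪θ, θ⟫_ℂ = ∫ y, ∫ y', χ y * conj (χ y') * (∫ x, k x y * conj (k x y') ∂μ) ∂ν ∂ν`
  — i.e. `hnorm` with `K u u' := ∫_{[G_U]} θ_φ(g,u) \overline{θ_φ(g,u′)} dg`, which is exactly the left-hand
  side of pv15's kernel identity `SiegelWeil.N31d_statement` (l. 580) and of pv09's `hK`.
-/
import Mathlib
import Summits.HodgeConjecture.HodgeCM.PerL34.RallisField

/-! PORT of `HodgeCM/PerL34/PeterssonFubini.lean` (HodgeCMPerL run 82) — verbatim mechanical port; provenance in the PORT header line. -/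

set_option autoImplicit false

noncomputable section

open MeasureTheory Complex ComplexConjugate
open scoped InnerProductSpace

namespace HodgeCM
namespace PerL34
namespace PeterssonFubini

/-- bounded + measurable ⇒ integrable, on a finite measure space. -/
theorem integrable_of_bdd {α : Type*} [MeasurableSpace α] {μ : Measure α} [IsFiniteMeasure μ]
    {f : α → ℂ} (hf : Measurable f) (C : ℝ) (hC : ∀ a, ‖f a‖ ≤ C) : Integrable f μ :=
  ⟨hf.aestronglyMeasurable, HasFiniteIntegral.of_bounded (ae_of_all μ hC)⟩

variable {X Y : Type*} [MeasurableSpace X] [MeasurableSpace Y]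

/-- `θ_φ(χ′)(x) := ∫_Y k(x,y) χ′(y) dν(y)` (tex l. 594, with `k = θ_φ` the theta kernel). -/
def thetaFun (ν : Measure Y) (k : X → Y → ℂ) (χ : Y → ℂ) (x : X) : ℂ := ∫ y, k x y * χ y ∂ν

section bounds

variable (ν : Measure Y) [IsFiniteMeasure ν] {k : X → Y → ℂ} {χ : Y → ℂ}
  (hk : Measurable (Function.uncurry k)) (hχ : Measurable χ)
  {Ck Cχ : ℝ} (hCk : 0 ≤ Ck) (hkC : ∀ x y, ‖k x y‖ ≤ Ck) (hχC : ∀ y, ‖χ y‖ ≤ Cχ)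

include hk hχ in
/-- (Ported verbatim from the HodgeCMPerL package; no docstring in the source.) -/
theorem stronglyMeasurable_thetaFun : StronglyMeasurable (thetaFun ν k χ) := by
  have hm : Measurable (Function.uncurry fun x y => k x y * χ y) := hk.mul (hχ.comp measurable_snd)
  exact hm.stronglyMeasurable.integral_prod_right

omit [MeasurableSpace X] [MeasurableSpace Y] in
include hCk hkC hχC in
/-- (Ported verbatim from the HodgeCMPerL package; no docstring in the source.) -/
theorem norm_integrand_le (x : X) (y : Y) : ‖k x y * χ y‖ ≤ Ck * Cχ := by
  rw [norm_mul]
  exact mul_le_mul (hkC x y) (hχC y) (norm_nonneg _) hCk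

omit [MeasurableSpace X] in
include hCk hkC hχC in
/-- (Ported verbatim from the HodgeCMPerL package; no docstring in the source.) -/
theorem norm_thetaFun_le (x : X) : ‖thetaFun ν k χ x‖ ≤ Ck * Cχ * ν.real Set.univ :=
  norm_integral_le_of_norm_le_const (ae_of_all ν (fun y => norm_integrand_le hCk hkC hχC x y))

include hk hχ hCk hkC hχC in
/-- `θ_φ(χ′) ∈ L²(μ)` for any finite measure `μ` on `X`. -/
theorem memLp_thetaFun (μ : Measure X) [IsFiniteMeasure μ] : MemLp (thetaFun ν k χ) 2 μ :=
  MemLp.of_bound (stronglyMeasurable_thetaFun ν hk hχ).aestronglyMeasurable _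
    (ae_of_all μ (norm_thetaFun_le ν hCk hkC hχC))

end bounds

section main

variable (μ : Measure X) (ν : Measure Y) [IsFiniteMeasure μ] [IsFiniteMeasure ν]
  {k : X → Y → ℂ} {χ : Y → ℂ}
  (hk : Measurable (Function.uncurry k)) (hχ : Measurable χ)
  {Ck Cχ : ℝ} (hCk : 0 ≤ Ck) (hCχ : 0 ≤ Cχ) (hkC : ∀ x y, ‖k x y‖ ≤ Ck) (hχC : ∀ y, ‖χ y‖ ≤ Cχ)

/-- `θ := θ_φ(χ′)` as an element of `L²(μ)`. -/
def theta : Lp ℂ 2 μ := (memLp_thetaFun ν hk hχ hCk hkC hχC μ).toLp _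

/-- (Ported verbatim from the HodgeCMPerL package; no docstring in the source.) -/
theorem theta_coeFn : (theta μ ν hk hχ hCk hkC hχC : X → ℂ) =ᵐ[μ] thetaFun ν k χ :=
  MemLp.coeFn_toLp _

/-- The triple integrand `G(x,(y,y')) = k(x,y)χ(y) · \overline{k(x,y')χ(y')}`. -/
def G (k : X → Y → ℂ) (χ : Y → ℂ) (p : X × (Y × Y)) : ℂ :=
  (k p.1 p.2.1 * χ p.2.1) * (conj (k p.1 p.2.2) * conj (χ p.2.2))

include hk hχ in
/-- (Ported verbatim from the HodgeCMPerL package; no docstring in the source.) -/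
theorem measurable_G : Measurable (G k χ) := by
  have m1 : Measurable fun p : X × (Y × Y) => k p.1 p.2.1 :=
    hk.comp (measurable_fst.prodMk (measurable_fst.comp measurable_snd))
  have m2 : Measurable fun p : X × (Y × Y) => χ p.2.1 := hχ.comp (measurable_fst.comp measurable_snd)
  have m3 : Measurable fun p : X × (Y × Y) => k p.1 p.2.2 :=
    hk.comp (measurable_fst.prodMk (measurable_snd.comp measurable_snd))
  have m4 : Measurable fun p : X × (Y × Y) => χ p.2.2 := hχ.comp (measurable_snd.comp measurable_snd)
  exact (m1.mul m2).mul ((continuous_conj.measurable.comp m3).mul (continuous_conj.measurable.comp m4))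

omit [MeasurableSpace X] [MeasurableSpace Y] in
include hCk hkC hχC in
/-- (Ported verbatim from the HodgeCMPerL package; no docstring in the source.) -/
theorem norm_G_le (p : X × (Y × Y)) : ‖G k χ p‖ ≤ (Ck * Cχ) * (Ck * Cχ) := by
  unfold G
  rw [norm_mul]
  refine mul_le_mul (norm_integrand_le hCk hkC hχC _ _) ?_ (norm_nonneg _) (mul_nonneg hCk ?_)
  · rw [norm_mul, Complex.norm_conj, Complex.norm_conj, ← norm_mul]
    exact norm_integrand_le hCk hkC hχC _ _
  · exact (norm_nonneg _).trans (hχC p.2.1)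

include hk hχ hCk hkC hχC in
/-- (Ported verbatim from the HodgeCMPerL package; no docstring in the source.) -/
theorem integrable_G : Integrable (G k χ) (μ.prod (ν.prod ν)) :=
  integrable_of_bdd (measurable_G hk hχ) _ (norm_G_le hCk hkC hχC)

include hk hχ hCk hkC hχC in
/-- (Ported verbatim from the HodgeCMPerL package; no docstring in the source.) -/
theorem integrable_G_slice (x : X) : Integrable (fun q : Y × Y => G k χ (x, q)) (ν.prod ν) :=
  integrable_of_bdd ((measurable_G hk hχ).comp measurable_prodMk_left) _
    (fun q => norm_G_le hCk hkC hχC (x, q))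

omit [MeasurableSpace X] [IsFiniteMeasure ν] in
/-- Step A: `\overline{θ(x)} θ(x) = ∫∫ G(x,(y,y')) dν dν` (product of two `ν`-integrals; no
integrability needed: `∫ c * f = c * ∫ f` holds unconditionally for the Bochner integral). -/
theorem conj_mul_thetaFun (x : X) :
    conj (thetaFun ν k χ x) * thetaFun ν k χ x = ∫ y, ∫ y', G k χ (x, (y, y')) ∂ν ∂ν := by
  unfold thetaFun
  rw [← integral_conj, mul_comm, ← integral_mul_const]
  congr 1
  ext y
  rw [← integral_const_mul]
  congr 1
  ext y'
  simp only [G, map_mul]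

include hk hχ hCk hkC hχC in
/-- **`hnorm` proved**: `⟪θ_φ(χ′), θ_φ(χ′)⟫ = ∫_Y ∫_Y χ′(y) \overline{χ′(y′)} (∫_X k(x,y) \overline{k(x,y′)} dμ) dν dν`
(tex l. 594–596: expand the norm of `θ_φ(χ′) = ∫ θ_φ(·,u)χ′(u)du` and exchange the `[G_U]`-integral with
the two `[U(W_i)]`-integrals — Fubini, everything bounded on finite measure spaces). -/
theorem inner_theta_theta :
    ⟪theta μ ν hk hχ hCk hkC hχC, theta μ ν hk hχ hCk hkC hχC⟫_ℂ
      = ∫ y, ∫ y', χ y * conj (χ y') * (∫ x, k x y * conj (k x y') ∂μ) ∂ν ∂ν := by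
  have hG := integrable_G μ ν hk hχ hCk hkC hχC
  -- (1) the inner product is `∫ conj θ · θ`
  have h1 : ⟪theta μ ν hk hχ hCk hkC hχC, theta μ ν hk hχ hCk hkC hχC⟫_ℂ
      = ∫ x, conj (thetaFun ν k χ x) * thetaFun ν k χ x ∂μ := by
    rw [L2.inner_def]
    apply integral_congr_ae
    filter_upwards [theta_coeFn μ ν hk hχ hCk hkC hχC] with x hx
    rw [hx, RCLike.inner_apply']
  -- (2) LHS as the integral of `G` over the triple product
  have h2 : ∫ x, conj (thetaFun ν k χ x) * thetaFun ν k χ x ∂μ = ∫ p, G k χ p ∂(μ.prod (ν.prod ν)) := by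
    rw [integral_prod _ hG]
    apply integral_congr_ae
    filter_upwards with x
    rw [conj_mul_thetaFun ν x,
      integral_prod (fun q : Y × Y => G k χ (x, q)) (integrable_G_slice ν hk hχ hCk hkC hχC x)]
  -- (3) RHS as the same triple integral, integrating over `X` first
  have h3 : ∫ y, ∫ y', χ y * conj (χ y') * (∫ x, k x y * conj (k x y') ∂μ) ∂ν ∂ν
      = ∫ p, G k χ p ∂(μ.prod (ν.prod ν)) := by
    rw [integral_prod_symm _ hG, integral_prod _ hG.integral_prod_right]
    apply integral_congr_ae
    filter_upwards with y
    apply integral_congr_ae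
    filter_upwards with y'
    rw [← integral_const_mul]
    apply integral_congr_ae
    filter_upwards with x
    simp only [G]
    ring
  rw [h1, h2, h3]

/-- The same in pv09's `∫ u in 𝓕, … ∂μ_A` shape: take `ν := μ_A.restrict 𝓕` (the set-integral notation
unfolds to exactly this), finiteness of `ν` being `μ_A 𝓕 < ∞` (`isFiniteMeasure_restrict`). -/
theorem inner_theta_theta_restrict (μA : Measure Y) (𝓕 : Set Y) [IsFiniteMeasure (μA.restrict 𝓕)] :
    ⟪theta μ (μA.restrict 𝓕) hk hχ hCk hkC hχC, theta μ (μA.restrict 𝓕) hk hχ hCk hkC hχC⟫_ℂ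
      = ∫ u in 𝓕, ∫ u' in 𝓕, χ u * conj (χ u') * (∫ x, k x u * conj (k x u') ∂μ) ∂μA ∂μA :=
  inner_theta_theta μ (μA.restrict 𝓕) hk hχ hCk hkC hχC

end main

section plug

/-! ## By-name plug into pv09's `RallisIP.rallis_field_of_N31e` (its `hnorm` binder discharged)
With `E := L²(μ)` (`μ` = the measure of `[G_U]`), `θ := theta …` (the genuine theta lift of `χ′` against the
kernel `k = θ_φ(·,·)`), and `K u u' := ∫ x, k x u * conj (k x u') ∂μ` (the `[G_U]`-inner integral of
N31d, l. 580): N31e + the Euler factorisation (N31f, first sentence) ⇒ the Rallis formula for `‖θ_φ(χ′)‖²`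
— no `hnorm` hypothesis left. -/

variable {A S : Type*} [CommGroup A] [NormedAddCommGroup S] [InnerProductSpace ℂ S] [MeasurableSpace A]

/-- (Ported verbatim from the HodgeCMPerL package; no docstring in the source.) -/
theorem rallis_field_of_theta (μ : Measure X) [IsFiniteMeasure μ] {μA : Measure A} {𝓕 : Set A}
    [IsFiniteMeasure (μA.restrict 𝓕)] {ω : A →* (S ≃ₗᵢ[ℂ] S)} {φ : S} {χ' : A → ℂ} {k : X → A → ℂ}
    (hk : Measurable (Function.uncurry k)) (hχ : Measurable χ') {Ck Cχ : ℝ} (hCk : 0 ≤ Ck)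
    (hkC : ∀ x u, ‖k x u‖ ≤ Ck) (hχC : ∀ u, ‖χ' u‖ ≤ Cχ) {c P : ℝ}
    (hN31e : RallisIP.N31e_statement μA 𝓕 ω φ χ' (fun u u' => ∫ x, k x u * conj (k x u') ∂μ) (c : ℂ))
    (hEuler : ∫ y, inner ℂ φ (ω y φ) * χ' y ∂μA = (P : ℂ)) :
    RCLike.re ⟪theta μ (μA.restrict 𝓕) hk hχ hCk hkC hχC, theta μ (μA.restrict 𝓕) hk hχ hCk hkC hχC⟫_ℂ
      = c * (μA 𝓕).toReal * P :=
  RallisIP.rallis_field_of_N31e hN31e (inner_theta_theta_restrict μ hk hχ hCk hkC hχC μA 𝓕) hEuler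

end plug

end PeterssonFubini
end PerL34
end HodgeCM

end
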